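import Summits.CriticalPhenomena.PercolationContinuityZ3.Theorems.PercNearOneGluingNoHeavyQuantLightResidDECOracle
import Summits.CriticalPhenomena.PercolationContinuityZ3.Theorems.PercNearOneGluingNoHeavyQuantLawDECFarSplit
import HarnessLib

/-!
# QUANT lane R8, T-DEC: THE RESIDUAL'S TAIL IS AT LEAST EVERY SIBLING'S SCALED TAIL — `R_a(≥ j+1) ≥ a·qᵢ·ρᵢ(≥ j+1)` for EVERY
# sibling `i` (k-general, law level), hence the residual is DEC at every layer reached by one sibling: PHASE 1 of the per-layer transport
# for `LightResidDECOracle` (arm-1 gen 52, architect)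

builds on p205010 (kernel theorem, internal audit signed; external expert review pending)

Support file (`--supports stmt-CriticalPhenomena-4575`), QUANT lane seat prim-quant-arm-1 (gen 52, architect), rung R8 of
`run/shared/lean/prim/quant/LADDER.md`; memo `run/shared/lean/prim/quant/prim-quant-arm-1-g52/ARCH-G52.md`.  Theorems only (no definition, no
`@[conjecture]`), standard axioms, no sorries.  Uses the root-scaled expansion of arm-1 g48 (`…QuantRootScaledExpansion`: `wco`, `resid`, the two
count-level inequalities (A) `rprod_mul_flaw_scale_le` and (B) `wco_mul_flaw_scale_le_gate`), the far-row sufficiency `decAt_of_tail_ge`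
(`…QuantLawDECFarSplit`) and the dominant-range soundness `tail_ge_of_decAt` (`…QuantLawDEC`).

WHAT (ARCH-G52 §2).  For a list `L` of law-OK siblings `tᵢ = gate ρᵢ qᵢ`, an outer gate `0 < a ≤ 1` and any weight `w ≤ wco a L`, the signed
law `a·flaw L − w·flaw Lₐ` (which is `(1 − w)·resid a w L` away from the atom `0`) has, above EVERY layer `j`, at least the mass
`(1 − w)·a·qᵢ·Σ_{h ≥ j+1} ρᵢ h` for EVERY member `i` (`resid_tail_core`): put differently, in the residual the event "root `i` open and `Nᵢ ≥ j+1`"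
keeps its natural probability `a·qᵢ·ρᵢ(≥ j+1)` as a LOWER bound (`resid_tail_ge_sibling`) — the residual's root marginals are exactly `a·qᵢ`
and removing the product part only removes mass pattern-wise below (A)/(B).  The proof is a list induction: for the head the open-root part of
`a·flaw L − w·flaw Lₐ` is `a q·(flaw L′ − w·flaw L′ₐ) ∗ ρ` (nonnegative by (A), mass `1 − w`) and the closed-root part is nonnegative away from `0`
by (B) with the weight `w/rfac ≤ wco L′`; for a tail member the scaled head `gate ρ (a q) = a·gate ρ q + (1 − a)·δ₀` passes the claim down to `L′`
(`tail_lconv_ge_left/right`: the tail of a convolution dominates tail × mass of either factor).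
CONSEQUENCES (per layer, k-general, no tree structure):
* **`decAt_resid_of_sibling_tail`** — at ANY layer `j` and floor `0 < y ≤ a·qᵢ·ρᵢ(≥ j+1)` for some member `i`, `resid a w L` is DEC(j) (all lows
  ride the giants, `decAt_of_tail_ge`);
* **`tail_ge_subfloor_of_sdecLight`** — an `SDECLight` law at sub-floor `x₁` (light or heavy) has `ρ(≥ j+1) ≥ x₁` at every layer `j` with
  `2j·max(1, 2x₁) < mean ρ` (the light oracle at the gate `min 1 (1/(2x₁))`, then `tail_ge_of_decAt`);
* **`decAt_resid_of_oracle_sibling`** — hence for an ORACLE-OK sibling (`Sib.OracleOK`: `x ≤ qᵢ·x₁ᵢ`, `SDECLight x₁ᵢ Mᵢ ρᵢ`) the residual at the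
  capped floor `min (a·x) (1/2)` is DEC at every layer `j` with `2j·max(1, 2x₁ᵢ) < mean ρᵢ`: in the near-sure-giant regime of ARCH-G50/51 these are
  ALL layers below the giant's dominant range (the far-row-tight "gap" layers of the per-layer-only censuses), certified once and for all.
What is NOT here: the layers above every sibling's reach (PHASE 2: the far atoms as light credit partners) — `LightResidDECOracle`, `LightResidDEC`,
`LightSiblingStep`, `FarTreeRow` remain OPEN; RATE class log\* / honest sentence of `run/shared/lean/prim/quant/README.md` unchanged.
[this work]; expansion (A)/(B): prim-quant-arm-1 g48; far-row ends: prim-quant-stmt g18 / census-2.  Nothing here is cited as a published result.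
The gluing rows served [cite: KozmaNitzan2024, Conjecture 3 (p. 15)]; product measure [cite: Grimmett1999, §1.3 p. 10].
-/

noncomputable section

open scoped BigOperators

namespace Summit.CriticalPhenomena.PercolationContinuityZ3.Theorems
namespace Quant
namespace LawDec

open Finset

/-! ### Tails of a convolution -/

/-- the tail of `lconv` above layer `j` as a double sum over the factors' atoms. [this work] -/
theorem tail_lconv_eq (M₁ M₂ j : ℕ) (μ ν : ℕ → ℝ) :
    ∑ h ∈ Finset.Ico (j + 1) (M₁ + M₂ + 1), lconv M₁ M₂ μ ν h
      = ∑ i ∈ Finset.range (M₁ + 1), ∑ k ∈ Finset.range (M₂ + 1), (if j + 1 ≤ i + k then μ i * ν k else 0) := by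
  simp only [lconv]
  rw [Finset.sum_comm]
  refine Finset.sum_congr rfl fun i hi => ?_
  rw [Finset.sum_comm]
  refine Finset.sum_congr rfl fun k hk => ?_
  rw [Finset.mem_range] at hi hk
  rw [Finset.sum_ite_eq]
  by_cases hjk : j + 1 ≤ i + k
  · rw [if_pos (Finset.mem_Ico.2 ⟨hjk, by omega⟩), if_pos hjk]
  · rw [if_neg (fun hm => hjk (Finset.mem_Ico.1 hm).1), if_neg hjk]

/-- **the tail of a convolution dominates (tail of the left factor) × (mass of the right factor)** (nonnegative factors). [this work] -/
theorem tail_lconv_ge_left (M₁ M₂ j : ℕ) (μ ν : ℕ → ℝ) (hμ : ∀ h, 0 ≤ μ h) (hν : ∀ h, 0 ≤ ν h) :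
    (∑ i ∈ Finset.Ico (j + 1) (M₁ + 1), μ i) * (∑ k ∈ Finset.range (M₂ + 1), ν k)
      ≤ ∑ h ∈ Finset.Ico (j + 1) (M₁ + M₂ + 1), lconv M₁ M₂ μ ν h := by
  rw [tail_lconv_eq, Finset.sum_mul]
  have hsub : Finset.Ico (j + 1) (M₁ + 1) ⊆ Finset.range (M₁ + 1) := fun i hi => by
    rw [Finset.mem_Ico] at hi; exact Finset.mem_range.2 hi.2
  have hnn : ∀ i ∈ Finset.range (M₁ + 1), 0 ≤ ∑ k ∈ Finset.range (M₂ + 1), (if j + 1 ≤ i + k then μ i * ν k else 0) :=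
    fun i _ => Finset.sum_nonneg fun k _ => by split_ifs; exacts [mul_nonneg (hμ i) (hν k), le_rfl]
  refine le_trans ?_ (Finset.sum_le_sum_of_subset_of_nonneg hsub fun i hi _ => hnn i hi)
  refine Finset.sum_le_sum fun i hi => ?_
  rw [Finset.mem_Ico] at hi
  rw [Finset.mul_sum]
  refine Finset.sum_le_sum fun k _ => ?_
  rw [if_pos (by omega)]

/-- **the tail of a convolution dominates (mass of the left factor) × (tail of the right factor)** (nonnegative factors). [this work] -/
theorem tail_lconv_ge_right (M₁ M₂ j : ℕ) (μ ν : ℕ → ℝ) (hμ : ∀ h, 0 ≤ μ h) (hν : ∀ h, 0 ≤ ν h) :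
    (∑ i ∈ Finset.range (M₁ + 1), μ i) * (∑ k ∈ Finset.Ico (j + 1) (M₂ + 1), ν k)
      ≤ ∑ h ∈ Finset.Ico (j + 1) (M₁ + M₂ + 1), lconv M₁ M₂ μ ν h := by
  rw [tail_lconv_eq, Finset.sum_mul]
  refine Finset.sum_le_sum fun i _ => ?_
  have hsub : Finset.Ico (j + 1) (M₂ + 1) ⊆ Finset.range (M₂ + 1) := fun k hk => by
    rw [Finset.mem_Ico] at hk; exact Finset.mem_range.2 hk.2
  rw [Finset.mul_sum]
  refine le_trans ?_ (Finset.sum_le_sum_of_subset_of_nonneg hsub fun k _ _ => by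
    split_ifs; exacts [mul_nonneg (hμ i) (hν k), le_rfl])
  refine Finset.sum_le_sum fun k hk => ?_
  rw [Finset.mem_Ico] at hk
  rw [if_pos (by omega)]

/-- a tail sum over a longer range equals the tail sum up to the top when the function vanishes above the top. [this work] -/
theorem tail_sum_extend (M N j : ℕ) (f : ℕ → ℝ) (hMN : M ≤ N) (hf : ∀ h, M < h → f h = 0) :
    ∑ h ∈ Finset.Ico (j + 1) (N + 1), f h = ∑ h ∈ Finset.Ico (j + 1) (M + 1), f h := by
  symm
  refine Finset.sum_subset (fun h hh => ?_) (fun h hN hM => ?_)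
  · rw [Finset.mem_Ico] at hh ⊢; exact ⟨hh.1, by omega⟩
  · rw [Finset.mem_Ico] at hN hM
    exact hf h (by omega)

/-! ### The core tail bound of the root-scaled expansion -/

/-- **CORE TAIL BOUND.**  For law-OK siblings, `0 < a ≤ 1` and any `w ≤ wco a L`: for EVERY member `s` and every layer `j`,
`(1 − w)·a·q_s·Σ_{h ≥ j+1} ρ_s h ≤ Σ_{j+1 ≤ h ≤ ftop L} (a·flaw L h − w·flaw Lₐ h)`.  List induction; head: open part by (A) on the tail
list, closed part nonnegative away from `0` by (B) on the tail list at weight `w/rfac`; tail member: `gate ρ (a q) = a·gate ρ q + (1−a)·δ₀` passes the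
claim down. [this work] -/
theorem resid_tail_core {a : ℝ} (ha0 : 0 < a) (ha1 : a ≤ 1) :
    ∀ L : List Sib, (∀ s ∈ L, s.LawOK) → ∀ w : ℝ, w ≤ wco a L → ∀ s ∈ L, ∀ j : ℕ,
      (1 - w) * (a * s.q * ∑ h ∈ Finset.Ico (j + 1) (s.M + 1), s.ρ h)
        ≤ ∑ h ∈ Finset.Ico (j + 1) (ftop L + 1), (a * flaw L h - w * flaw (L.map (Sib.scale a)) h)
  | [], _, _, _, s, hs, _ => absurd hs List.not_mem_nil
  | t :: L', hL, w, hw, s, hs, j => by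
    have ht := hL t List.mem_cons_self
    have hL' : ∀ u ∈ L', u.LawOK := fun u hu => hL u (List.mem_cons_of_mem t hu)
    obtain ⟨hq0, hq1, ρ0, ρM, ρ1⟩ := ht
    obtain ⟨f0, fM, f1, _⟩ := flaw_facts L' hL'
    obtain ⟨fa0, faM, fa1, _⟩ := flaw_facts (L'.map (Sib.scale a)) (map_scale_lawOK ha0 ha1 L' hL')
    rw [ftop_map_scale] at faM fa1
    obtain ⟨hr0, hr1, hrq, _, _⟩ := rfac_facts ha1 (hL t List.mem_cons_self)
    -- the two weight bounds on the tail list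
    have hwP : w ≤ rprod a L' := by
      refine hw.trans ?_
      rcases L' with _ | ⟨u, L''⟩
      · simp [wco, rprod]
      · exact (wco_cons_cons_le a t u L'').1
    have hwW : L' ≠ [] → w ≤ rfac a t * wco a L' := by
      intro hne
      obtain ⟨u, L'', rfl⟩ := List.exists_cons_of_ne_nil hne
      exact hw.trans (wco_cons_cons_le a t u L'').2
    -- the signed law `E = flaw L′ − w·flaw L′ₐ` is nonnegative, by (A)
    set E : ℕ → ℝ := fun k => flaw L' k - w * flaw (L'.map (Sib.scale a)) k with hE
    have hE0 : ∀ k, 0 ≤ E k := by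
      intro k
      have hA := rprod_mul_flaw_scale_le ha0 ha1 L' hL' k
      have : w * flaw (L'.map (Sib.scale a)) k ≤ rprod a L' * flaw (L'.map (Sib.scale a)) k :=
        mul_le_mul_of_nonneg_right hwP (fa0 k)
      simp only [hE]; linarith
    have hEsum : ∑ k ∈ Finset.range (ftop L' + 1), E k = 1 - w := by
      simp only [hE]
      rw [Finset.sum_sub_distrib, ← Finset.mul_sum, f1, fa1, mul_one]
    have hElin : ∀ ν : ℕ → ℝ, ∀ h, lconv (ftop L') t.M E ν h
        = lconv (ftop L') t.M (flaw L') ν h - w * lconv (ftop L') t.M (flaw (L'.map (Sib.scale a))) ν h := by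
      intro ν h
      have e : E = fun k => 1 * flaw L' k + (-w) * flaw (L'.map (Sib.scale a)) k := by
        funext k; simp only [hE]; ring
      rw [e, lconv_lin_left]; ring
    -- unfold the two forest laws of `t :: L′` along the head
    have eF : ∀ h, flaw (t :: L') h = t.q * lconv (ftop L') t.M (flaw L') t.ρ h + (1 - t.q) * flaw L' h := by
      intro h
      show lconv (ftop L') t.M (flaw L') (gate t.ρ t.q) h = _
      exact lconv_gate_right _ _ _ _ _ fM h
    have eFa : ∀ h, flaw ((t :: L').map (Sib.scale a)) h
        = a * t.q * lconv (ftop L') t.M (flaw (L'.map (Sib.scale a))) t.ρ h + (1 - a * t.q) * flaw (L'.map (Sib.scale a)) h := by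
      intro h
      rw [flaw_map_scale_cons, lconv_gate_right _ _ _ _ _ faM h]
    have etop : ftop (t :: L') = ftop L' + t.M := rfl
    rcases List.mem_cons.1 hs with rfl | hs'
    · /- the member is the HEAD `s = t` -/
      -- pointwise: `a·flaw − w·flaw_a = a q·(E ∗ ρ) + C` with `C ≥ 0` away from `0`
      have hC : ∀ h, h ≠ 0 → 0 ≤ a * ((1 - s.q) * flaw L' h) - w * ((1 - a * s.q) * flaw (L'.map (Sib.scale a)) h) := by
        intro h hh
        by_cases hne : L' = []
        · subst hne
          simp only [List.map_nil, flaw, if_neg hh, mul_zero, sub_zero]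
          exact le_rfl
        · have hB := wco_mul_flaw_scale_le_gate ha0 ha1 L' hL' h
          rw [gate_apply, if_neg hh, mul_zero, add_zero] at hB
          obtain ⟨hW0, _, _⟩ := wco_facts ha1 L' hL'
          have h1 : w * ((1 - a * s.q) * flaw (L'.map (Sib.scale a)) h)
              ≤ (rfac a s * wco a L') * ((1 - a * s.q) * flaw (L'.map (Sib.scale a)) h) :=
            mul_le_mul_of_nonneg_right (hwW hne) (mul_nonneg (by nlinarith) (fa0 h))
          have h2 : (rfac a s * wco a L') * ((1 - a * s.q) * flaw (L'.map (Sib.scale a)) h)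
              = (1 - s.q) * (wco a L' * flaw (L'.map (Sib.scale a)) h) := by
            calc (rfac a s * wco a L') * ((1 - a * s.q) * flaw (L'.map (Sib.scale a)) h)
                = (rfac a s * (1 - a * s.q)) * (wco a L' * flaw (L'.map (Sib.scale a)) h) := by ring
              _ = (1 - s.q) * (wco a L' * flaw (L'.map (Sib.scale a)) h) := by rw [hrq]
          have h3 : (1 - s.q) * (wco a L' * flaw (L'.map (Sib.scale a)) h) ≤ (1 - s.q) * (a * flaw L' h) :=
            mul_le_mul_of_nonneg_left hB (by linarith)
          nlinarith
      have epoint : ∀ h, a * flaw (s :: L') h - w * flaw ((s :: L').map (Sib.scale a)) h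
          = a * s.q * lconv (ftop L') s.M E s.ρ h
            + (a * ((1 - s.q) * flaw L' h) - w * ((1 - a * s.q) * flaw (L'.map (Sib.scale a)) h)) := by
        intro h
        rw [eF h, eFa h, hElin s.ρ h]
        ring
      rw [etop, Finset.sum_congr rfl fun h _ => epoint h, Finset.sum_add_distrib, ← Finset.mul_sum]
      have hconv : (∑ i ∈ Finset.range (ftop L' + 1), E i) * (∑ k ∈ Finset.Ico (j + 1) (s.M + 1), s.ρ k)
          ≤ ∑ h ∈ Finset.Ico (j + 1) (ftop L' + s.M + 1), lconv (ftop L') s.M E s.ρ h :=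
        tail_lconv_ge_right (ftop L') s.M j E s.ρ hE0 ρ0
      rw [hEsum] at hconv
      have hCsum : 0 ≤ ∑ h ∈ Finset.Ico (j + 1) (ftop L' + s.M + 1),
          (a * ((1 - s.q) * flaw L' h) - w * ((1 - a * s.q) * flaw (L'.map (Sib.scale a)) h)) :=
        Finset.sum_nonneg fun h hh => hC h (by rw [Finset.mem_Ico] at hh; omega)
      have haq : 0 ≤ a * s.q := mul_nonneg ha0.le hq0.le
      calc (1 - w) * (a * s.q * ∑ h ∈ Finset.Ico (j + 1) (s.M + 1), s.ρ h)
          = a * s.q * ((1 - w) * ∑ k ∈ Finset.Ico (j + 1) (s.M + 1), s.ρ k) := by ring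
        _ ≤ a * s.q * ∑ h ∈ Finset.Ico (j + 1) (ftop L' + s.M + 1), lconv (ftop L') s.M E s.ρ h :=
            mul_le_mul_of_nonneg_left hconv haq
        _ ≤ _ := le_add_of_nonneg_right hCsum
    · /- the member lies in the TAIL `L′` -/
      have hne : L' ≠ [] := List.ne_nil_of_mem hs'
      have hwL' : w ≤ wco a L' := by
        obtain ⟨hW0, hW1, _⟩ := wco_facts ha1 L' hL'
        have := hwW hne
        nlinarith
      have ih := resid_tail_core ha0 ha1 L' hL' w hwL' s hs' j
      -- pointwise: `a·flaw − w·flaw_a = a·(E ∗ gate ρ_t q_t) − w(1−a)·flaw L′ₐ`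
      have g0 : ∀ k, 0 ≤ gate t.ρ t.q k := by
        intro k; rw [gate_apply]; split_ifs <;> nlinarith [ρ0 k]
      have g1 : ∑ k ∈ Finset.range (t.M + 1), gate t.ρ t.q k = 1 := sum_gate t.ρ t.q t.M ρ1
      have egate : gate t.ρ (a * t.q) = fun k => a * gate t.ρ t.q k + (1 - a) * (if k = 0 then (1 : ℝ) else 0) := by
        funext k; rw [gate_apply, gate_apply]; ring
      have epoint : ∀ h, a * flaw (t :: L') h - w * flaw ((t :: L').map (Sib.scale a)) h
          = a * lconv (ftop L') t.M E (gate t.ρ t.q) h - w * ((1 - a) * flaw (L'.map (Sib.scale a)) h) := by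
        intro h
        rw [show flaw (t :: L') h = lconv (ftop L') t.M (flaw L') (gate t.ρ t.q) h from rfl, flaw_map_scale_cons, egate,
          lconv_lin_right, lconv_delta_right _ _ _ faM h, hElin]
        ring
      rw [etop, Finset.sum_congr rfl fun h _ => epoint h, Finset.sum_sub_distrib, ← Finset.mul_sum, ← Finset.mul_sum]
      have hconv : (∑ i ∈ Finset.Ico (j + 1) (ftop L' + 1), E i) * (∑ k ∈ Finset.range (t.M + 1), gate t.ρ t.q k)
          ≤ ∑ h ∈ Finset.Ico (j + 1) (ftop L' + t.M + 1), lconv (ftop L') t.M E (gate t.ρ t.q) h :=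
        tail_lconv_ge_left (ftop L') t.M j E (gate t.ρ t.q) hE0 g0
      rw [g1, mul_one] at hconv
      have hext : ∑ h ∈ Finset.Ico (j + 1) (ftop L' + t.M + 1), (1 - a) * flaw (L'.map (Sib.scale a)) h
          = ∑ h ∈ Finset.Ico (j + 1) (ftop L' + 1), (1 - a) * flaw (L'.map (Sib.scale a)) h :=
        tail_sum_extend (ftop L') (ftop L' + t.M) j _ (by omega) (fun h hh => by rw [faM h hh, mul_zero])
      rw [hext]
      have hEtail : ∑ i ∈ Finset.Ico (j + 1) (ftop L' + 1), E i
          = ∑ i ∈ Finset.Ico (j + 1) (ftop L' + 1), flaw L' i - w * ∑ i ∈ Finset.Ico (j + 1) (ftop L' + 1), flaw (L'.map (Sib.scale a)) i := by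
        simp only [hE]; rw [Finset.sum_sub_distrib, ← Finset.mul_sum]
      have hih' : (1 - w) * (a * s.q * ∑ h ∈ Finset.Ico (j + 1) (s.M + 1), s.ρ h)
          ≤ a * ∑ i ∈ Finset.Ico (j + 1) (ftop L' + 1), flaw L' i - w * ∑ i ∈ Finset.Ico (j + 1) (ftop L' + 1), flaw (L'.map (Sib.scale a)) i := by
        have := ih
        rw [Finset.sum_sub_distrib, ← Finset.mul_sum, ← Finset.mul_sum] at this
        exact this
      calc (1 - w) * (a * s.q * ∑ h ∈ Finset.Ico (j + 1) (s.M + 1), s.ρ h)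
          ≤ a * ∑ i ∈ Finset.Ico (j + 1) (ftop L' + 1), flaw L' i
              - w * ∑ i ∈ Finset.Ico (j + 1) (ftop L' + 1), flaw (L'.map (Sib.scale a)) i := hih'
        _ = a * (∑ i ∈ Finset.Ico (j + 1) (ftop L' + 1), E i)
              - w * ∑ h ∈ Finset.Ico (j + 1) (ftop L' + 1), (1 - a) * flaw (L'.map (Sib.scale a)) h := by
            rw [hEtail, ← Finset.mul_sum]; ring
        _ ≤ a * ∑ h ∈ Finset.Ico (j + 1) (ftop L' + t.M + 1), lconv (ftop L') t.M E (gate t.ρ t.q) h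
              - w * ∑ h ∈ Finset.Ico (j + 1) (ftop L' + 1), (1 - a) * flaw (L'.map (Sib.scale a)) h := by
            have := mul_le_mul_of_nonneg_left hconv ha0.le
            linarith

/-! ### The residual's tail and DEC at the layers one sibling reaches -/

/-- **`R(≥ j+1) ≥ a·qᵢ·ρᵢ(≥ j+1)` FOR EVERY SIBLING** (law-OK list, `0 < a ≤ 1`, `w ≤ wco a L`, `w < 1`). [this work] -/
theorem resid_tail_ge_sibling {a w : ℝ} (ha0 : 0 < a) (ha1 : a ≤ 1) (L : List Sib) (hL : ∀ s ∈ L, s.LawOK)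
    (hw : w ≤ wco a L) (hw1 : w < 1) (s : Sib) (hs : s ∈ L) (j : ℕ) :
    a * s.q * ∑ h ∈ Finset.Ico (j + 1) (s.M + 1), s.ρ h ≤ ∑ h ∈ Finset.Ico (j + 1) (ftop L + 1), resid a w L h := by
  have h1w : 0 < 1 - w := by linarith
  have hcore := resid_tail_core ha0 ha1 L hL w hw s hs j
  have e : ∀ h ∈ Finset.Ico (j + 1) (ftop L + 1),
      resid a w L h = (a * flaw L h - w * flaw (L.map (Sib.scale a)) h) / (1 - w) := by
    intro h hh
    rw [Finset.mem_Ico] at hh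
    simp only [resid]
    rw [gate_apply, if_neg (by omega), mul_zero, add_zero]
  rw [Finset.sum_congr rfl e, ← Finset.sum_div, le_div_iff₀ h1w]
  linarith

/-- **THE RESIDUAL IS DEC AT EVERY LAYER ONE SIBLING REACHES**: law-OK list, `0 < a ≤ 1`, `w ≤ wco a L`, `w < 1`, a member `s`, a layer `j`
and a floor `0 < y ≤ a·q_s·Σ_{h ≥ j+1} ρ_s h` ⟹ `DECAt y j (ftop L) (resid a w L)` (every low atom rides the giants, `decAt_of_tail_ge`).
[this work] -/
theorem decAt_resid_of_sibling_tail {a w y : ℝ} (ha0 : 0 < a) (ha1 : a ≤ 1) (L : List Sib) (hL : ∀ s ∈ L, s.LawOK)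
    (hw : w ≤ wco a L) (hw1 : w < 1) (s : Sib) (hs : s ∈ L) (j : ℕ) (hy0 : 0 < y)
    (hy : y ≤ a * s.q * ∑ h ∈ Finset.Ico (j + 1) (s.M + 1), s.ρ h) :
    DECAt y j (ftop L) (resid a w L) := by
  obtain ⟨r0, rM, r1, _⟩ := resid_laws ha0 ha1 L hL hw hw1
  exact decAt_of_tail_ge (ftop L) (resid a w L) r0 rM r1 y j hy0
    (hy.trans (resid_tail_ge_sibling ha0 ha1 L hL hw hw1 s hs j))

/-! ### The oracle supplies the sibling's tail: `ρ(≥ j+1) ≥ x₁` in the sibling's dominant range -/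

/-- **AN `SDECLight` LAW REACHES ABOVE EVERY LAYER OF ITS (FLOOR-ADJUSTED) DOMINANT RANGE WITH PROBABILITY `≥ x₁`**: `ρ` a probability law on
`{0..M}` with mean `m`, `SDECLight x₁ M ρ`, `0 < x₁`, `j < M` and `2j·max(1, 2x₁) < m` ⟹ `x₁ ≤ Σ_{h ≥ j+1} ρ h`.  (Gate the law by
`q′ = min 1 (1/(2x₁))`, whose capped floor is `min (q′x₁) (1/2) = q′·x₁`; the layer is dominant for `gate ρ q′` (mean `q′·m`), so `tail_ge_of_decAt`
gives `q′x₁ ≤ q′·ρ(≥ j+1)`.) [this work] -/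
theorem tail_ge_subfloor_of_sdecLight {x₁ : ℝ} {M : ℕ} {ρ : ℕ → ℝ} (hS : SDECLight x₁ M ρ) (hx0 : 0 < x₁) (j : ℕ) (hj : j < M)
    (hdom : 2 * (j : ℝ) * max 1 (2 * x₁) < ∑ h ∈ Finset.range (M + 1), (h : ℝ) * ρ h) :
    x₁ ≤ ∑ h ∈ Finset.Ico (j + 1) (M + 1), ρ h := by
  set q' : ℝ := min 1 (1 / (2 * x₁)) with hq'
  have hq'0 : 0 < q' := lt_min one_pos (by positivity)
  have hq'1 : q' ≤ 1 := min_le_left _ _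
  have hq'x : q' * x₁ ≤ 1 / 2 := by
    have : q' ≤ 1 / (2 * x₁) := min_le_right _ _
    calc q' * x₁ ≤ 1 / (2 * x₁) * x₁ := mul_le_mul_of_nonneg_right this hx0.le
      _ = 1 / 2 := by field_simp
  have hfloor : min (q' * x₁) (1 / 2) = q' * x₁ := min_eq_left hq'x
  -- `max 1 (2x₁) · q′ = 1`
  have hmq : max 1 (2 * x₁) * q' = 1 := by
    by_cases hx : 2 * x₁ ≤ 1
    · rw [max_eq_left hx, hq', min_eq_left ((one_le_div (by positivity)).2 hx)]; ring
    · have hx' : 1 < 2 * x₁ := lt_of_not_ge hx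
      rw [max_eq_right hx'.le, hq', min_eq_right ((div_le_one (by positivity)).2 hx'.le)]
      field_simp
  have hdec := hS q' hq'0 hq'1 j hj
  rw [hfloor] at hdec
  -- the mean of the gated law is `q′·m`, so the layer is dominant for it
  have hmean : ∑ h ∈ Finset.range (M + 1), (h : ℝ) * gate ρ q' h = q' * ∑ h ∈ Finset.range (M + 1), (h : ℝ) * ρ h :=
    sum_mul_gate ρ q' M
  have hdom' : (2 * j : ℝ) < ∑ h ∈ Finset.range (M + 1), (h : ℝ) * gate ρ q' h := by
    rw [hmean]
    have hmx : 1 ≤ max 1 (2 * x₁) := le_max_left _ _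
    have hj0 : (0 : ℝ) ≤ 2 * j := by positivity
    calc (2 * j : ℝ) = (2 * j * max 1 (2 * x₁)) * q' := by rw [mul_assoc (2 * (j : ℝ)), hmq, mul_one]
      _ < (∑ h ∈ Finset.range (M + 1), (h : ℝ) * ρ h) * q' := mul_lt_mul_of_pos_right hdom hq'0
      _ = q' * ∑ h ∈ Finset.range (M + 1), (h : ℝ) * ρ h := mul_comm _ _
  have htail := tail_ge_of_decAt (q' * x₁) j M (gate ρ q') (by linarith) hdec hdom'
  -- away from `0` the gated law is `q′·ρ`
  have e : ∀ h ∈ Finset.Ico (j + 1) (M + 1), gate ρ q' h = q' * ρ h := by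
    intro h hh
    rw [Finset.mem_Ico] at hh
    rw [gate_apply, if_neg (by omega), mul_zero, add_zero]
  rw [Finset.sum_congr rfl e, ← Finset.mul_sum] at htail
  exact le_of_mul_le_mul_left htail hq'0

/-- **THE RESIDUAL IS DEC AT EVERY LAYER OF AN ORACLE-OK SIBLING'S DOMINANT RANGE** (law level, k-general): law-OK siblings at floor
`0 < x`, an ORACLE-OK member `s` (`x ≤ q_s·x₁`, `SDECLight x₁ M_s ρ_s`), `0 < a ≤ 1`, `w ≤ wco a L`, `w < 1`, and a layer `j < M_s` with
`2j·max(1, 2x₁) < mean ρ_s` ⟹ `DECAt (min (a·x) (1/2)) j (ftop L) (resid a w L)`. [this work] -/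
theorem decAt_resid_of_oracle_sibling {x a w : ℝ} (hx0 : 0 < x) (ha0 : 0 < a) (ha1 : a ≤ 1) (L : List Sib) (hL : ∀ s ∈ L, s.LawOK)
    (hw : w ≤ wco a L) (hw1 : w < 1) (s : Sib) (hs : s ∈ L) (hO : s.OracleOK x) (j : ℕ) (hj : j < s.M)
    (hdom : 2 * (j : ℝ) * max 1 (2 * s.x₁) < s.mean) :
    DECAt (min (a * x) (1 / 2)) j (ftop L) (resid a w L) := by
  obtain ⟨⟨⟨hq0, _, _, _, _⟩, hx₁0, hxq, _⟩, hS⟩ := hO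
  have htail := tail_ge_subfloor_of_sdecLight hS hx₁0 j hj hdom
  refine decAt_resid_of_sibling_tail ha0 ha1 L hL hw hw1 s hs j (lt_min (mul_pos ha0 hx0) (by norm_num)) ?_
  calc min (a * x) (1 / 2) ≤ a * x := min_le_left _ _
    _ ≤ a * (s.q * s.x₁) := mul_le_mul_of_nonneg_left hxq ha0.le
    _ = a * s.q * s.x₁ := by ring
    _ ≤ a * s.q * ∑ h ∈ Finset.Ico (j + 1) (s.M + 1), s.ρ h := mul_le_mul_of_nonneg_left htail (mul_nonneg ha0.le hq0.le)

/-- **COROLLARY (the light node, canonical weight)**: for a list of `≥ 3` oracle-OK siblings at floor `0 < x < 1` (`SibFamOracle₃`) and an outer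
gate `0 < a < 1`, the canonical residual `resid a (wco a L) L` is DEC at the capped floor at every layer `j` lying in the floor-adjusted dominant
range `2j·max(1, 2x₁ᵢ) < mean ρᵢ` (`j < Mᵢ`) of SOME member `i` — the PHASE-1 layers of `LightResidDECAt x a L`. [this work] -/
theorem decAt_resid_canonical_of_oracle_sibling {x a : ℝ} (hx0 : 0 < x) (ha0 : 0 < a) (ha1 : a < 1) (L : List Sib)
    (hF : SibFamOracle₃ x L) (s : Sib) (hs : s ∈ L) (j : ℕ) (hj : j < s.M) (hdom : 2 * (j : ℝ) * max 1 (2 * s.x₁) < s.mean) :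
    DECAt (min (a * x) (1 / 2)) j (ftop L) (resid a (wco a L) L) := by
  have hL : ∀ u ∈ L, u.LawOK := fun u hu => (hF.1 u hu).affOK.1
  have hk : 3 ≤ L.length := hF.2
  obtain ⟨t, u, L', rfl⟩ : ∃ t u L', L = t :: u :: L' := by
    rcases L with _ | ⟨t, _ | ⟨u, L'⟩⟩
    · simp at hk
    · simp at hk
    · exact ⟨t, u, L', rfl⟩
  have hw1 : wco a (t :: u :: L') < 1 := wco_lt_one ha1 t u L' hL
  exact decAt_resid_of_oracle_sibling hx0 ha0 ha1.le _ hL le_rfl hw1 s hs (hF.1 s hs) j hj hdom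

end LawDec
end Quant
end Summit.CriticalPhenomena.PercolationContinuityZ3.Theorems
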